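import Mathlib
import Literature.MathematicalPhysics.MHD.SolovevFluxSurfaceGGJQuadratic
import Literature.MathematicalPhysics.MHD.SolovevFluxSurfaceGGJMonotone
import Literature.MathematicalPhysics.MHD.SolovevFluxSurfacePeeling
import HarnessLib

/-!
# The Mercier-stable set in the free constant is a THRESHOLD RAY OR EMPTY on every flux surface of the
# Lee–Cerfon / PCF Solov'ev family; the purely poloidal member (`g = 0`) violates Mercier on every surface
# (proved; no numerics)

Twelfth file of the `lcLoop` series (gridfusion-model-5).  `SolovevFluxSurfaceGGJQuadratic.lean`
(gridfusion-sos-6) proved that on the surface `r` of `Ψ = psiLC κ F_B R₀ q₀ a` with constant free function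
`F ≡ g` Jardin's flux-coordinate Mercier function (8.134) [bib `Jardin2010`] is `F(g) = g²·M₂ − M₀` with
`g`-free slope `M₂ = lcMercierSlope` and intercept `M₀ = lcMercierIntercept`, and gave the threshold form
`MercierCriterion ↔ M₀/M₂ < g²` UNDER THE HYPOTHESIS `M₂ > 0` (certified per surface by enclosures).

THIS FILE removes the hypothesis from the STRUCTURE statement.  For every member (`κ, F_B, R₀, q₀ > 0`, any
shift `a`) and every surface `0 < r < R₀/2`:
* `lcMercierIntercept_pos` — **`M₀ > 0`**: `M₀ = B₀·(C_s²E₁ + C_sV″/V′)` with `B₀ = ∫w/u ÷ ∫w > 0`,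
  `E₁ = ∫uw/G ÷ ∫w > 0` (`SolovevFluxSurfaceGGJMonotone`), `C_s > 0`, `V′ > 0` and `V″ > 0`
  (`SolovevFluxSurfacePeeling.lcGGJData_V''_pos`, the reflection argument);
* `mercierF_lcGGJData_zero`, **`not_mercierCriterion_lcGGJData_zero`** — `F(0) = −M₀ < 0`: WITHOUT TOROIDAL
  FIELD (the purely poloidal equilibrium with the same flux function) EVERY surface violates the criterion;
* **`mercierCriterion_lcGGJData_iff`** — `MercierCriterion ↔ (0 < M₂ ∧ M₀ < g²·M₂)` with NO hypothesis: a
  positive slope is NECESSARY for the criterion to hold at any `g` (`lcMercierSlope_pos_of_mercierCriterion`),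
  and `M₂ ≤ 0 ⇒ ¬ MercierCriterion ∀ g` (`not_mercierCriterion_of_slope_nonpos`);
* `lcMercierThreshold := √(M₀/M₂)`; for `M₂ > 0`: `0 < g_M`, `MercierCriterion ↔ g_M < |g|`
  (`mercierCriterion_lcGGJData_iff_threshold_lt_abs`), `¬ MercierCriterion ↔ |g| ≤ g_M`, and `F(±g_M) = 0`;
* `exists_pos_forall_abs_le_not_mercierCriterion` — on every surface there is `g₀ > 0` such that every
  `|g| ≤ g₀` violates the criterion (no surface is Mercier-stable for all values of the free constant);
* `setOf_mercierCriterion_eq` — `{g | MercierCriterion} = {g | g_M < |g|}` if `M₂ > 0`, `= ∅` otherwise.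
So a per-surface certificate can only ever be a two-sided threshold in `g` (the Bench rows
`SolovevPCF{Iter,Nstx}Mercier{Edge,Mid}Threshold` are instances), never «all `g`» and never «no threshold
but stable»; and the sign certificate `M₂ > 0` is exactly the statement «the surface is Mercier-stabilisable by
a toroidal field».
HONEST FRAMING (LADDER-GRIDFUSION three columns): exact real analysis about MODEL objects (ideal MHD, Solov'ev
profiles `p′ = −C_s`, `FF′ = 0`, analytic fixed boundary, Lee–Cerfon radial surface family); Mercier is a
NECESSARY local criterion — «violates Mercier» is an ideal-interchange INSTABILITY statement about model M,
«satisfies Mercier» is NOT a stability claim.  Typer/prover: gridfusion-model-5 (g5), 2026-08-27.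
-/

noncomputable section

namespace Literature.MathematicalPhysics.MHD.Solovev

open GradShafranov FluxGeometry Mercier.FluxForm _root_.Real MeasureTheory intervalIntegral _root_.Set

section threshold

variable {R₀ κ FB q₀ r : ℝ} (hR₀ : 0 < R₀) (hκ : 0 < κ) (hFB : 0 < FB) (hq₀ : 0 < q₀)
  (hr : 0 < r) (h2r : 2 * r < R₀)
include hR₀ hκ hFB hq₀ hr h2r

/-- The `g`-free integral `E = ∫₀^{2π} u·w/G dt` is positive. [cite: Jardin2010, §8.5.4 eq. (8.134)] -/
theorem integral_lcU_div_lcGradSq_mul_lcAvgWeight_pos :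
    0 < ∫ t in (0 : ℝ)..(2 * π), lcU R₀ r t / lcGradSq κ FB R₀ q₀ r t * lcAvgWeight κ FB R₀ q₀ r t := by
  have hJ := lcJ7_add_sq_mul_lcJ8 hR₀ hκ hFB hq₀ hr h2r (0 : ℝ)
  obtain ⟨-, -, -, h4, h5⟩ := integral_ggjBlocks_pos hR₀ hκ hFB hq₀ hr h2r (0 : ℝ)
  rw [← hJ]
  nlinarith [h4, h5]

/-- **The intercept is positive on every surface:** `M₀ = B₀·(C_s²E₁ + C_sV″/V′) > 0`.
[cite: Jardin2010, §8.5.4 eq. (8.134)] -/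
theorem lcMercierIntercept_pos (a : ℝ) : 0 < lcMercierIntercept κ FB R₀ q₀ a r := by
  obtain ⟨-, -, h3, -, -⟩ := integral_ggjBlocks_pos hR₀ hκ hFB hq₀ hr h2r (0 : ℝ)
  have hE := integral_lcU_div_lcGradSq_mul_lcAvgWeight_pos hR₀ hκ hFB hq₀ hr h2r
  have hIw := integral_lcAvgWeight_pos hR₀ hκ hFB hq₀ hr.le h2r
  have hC := csLC_pos' hR₀ hκ hFB hq₀
  have hV'' := lcGGJData_V''_pos hR₀ hκ hFB hq₀ hr h2r a 1
  have hV' : 0 < (lcGGJData κ FB R₀ q₀ a 1 r).V' := volumeDerivE_lcLoop_pos hR₀ hκ hFB hq₀ hr h2r a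
  unfold lcMercierIntercept
  positivity

/-- `F(0) = −M₀`: the Mercier function of the purely poloidal member. [cite: Jardin2010, §8.5.4 eq. (8.134)] -/
theorem mercierF_lcGGJData_zero (a : ℝ) :
    (lcGGJData κ FB R₀ q₀ a 0 r).mercierF = -lcMercierIntercept κ FB R₀ q₀ a r := by
  rw [mercierF_lcGGJData_explicit hR₀ hκ hFB hq₀ hr h2r a 0]
  ring

/-- **Without toroidal field every surface violates Mercier:** `F(0) < 0`, i.e. `¬ MercierCriterion` at `g = 0`,
for every member of the family and every surface `0 < r < R₀/2` (ideal-interchange instability of the purely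
poloidal model equilibrium). [cite: Jardin2010, §8.5.4 eq. (8.134)] -/
theorem not_mercierCriterion_lcGGJData_zero (a : ℝ) : ¬ (lcGGJData κ FB R₀ q₀ a 0 r).MercierCriterion := by
  unfold SurfaceData.MercierCriterion
  rw [mercierF_lcGGJData_zero hR₀ hκ hFB hq₀ hr h2r a]
  have := lcMercierIntercept_pos hR₀ hκ hFB hq₀ hr h2r a
  linarith

/-- **A positive slope is necessary:** if the criterion holds at some `g` then `M₂ > 0`.
[cite: Jardin2010, §8.5.4 eq. (8.134)] -/
theorem lcMercierSlope_pos_of_mercierCriterion {a g : ℝ} (h : (lcGGJData κ FB R₀ q₀ a g r).MercierCriterion) :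
    0 < lcMercierSlope κ FB R₀ q₀ a r := by
  unfold SurfaceData.MercierCriterion at h
  rw [mercierF_lcGGJData_explicit hR₀ hκ hFB hq₀ hr h2r a g] at h
  have hM₀ := lcMercierIntercept_pos hR₀ hκ hFB hq₀ hr h2r a
  by_contra hle
  push Not at hle
  have : g ^ 2 * lcMercierSlope κ FB R₀ q₀ a r ≤ 0 := mul_nonpos_of_nonneg_of_nonpos (sq_nonneg g) hle
  linarith

/-- If the slope is non-positive the criterion fails for EVERY value of the free constant.
[cite: Jardin2010, §8.5.4 eq. (8.134)] -/
theorem not_mercierCriterion_of_slope_nonpos {a : ℝ} (hM : lcMercierSlope κ FB R₀ q₀ a r ≤ 0) (g : ℝ) :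
    ¬ (lcGGJData κ FB R₀ q₀ a g r).MercierCriterion := fun h =>
  absurd (lcMercierSlope_pos_of_mercierCriterion hR₀ hκ hFB hq₀ hr h2r h) (not_lt.mpr hM)

/-- **The criterion with no hypothesis:** `MercierCriterion ↔ (0 < M₂ ∧ M₀ < g²·M₂)`.
[cite: Jardin2010, §8.5.4 eq. (8.134)] -/
theorem mercierCriterion_lcGGJData_iff (a g : ℝ) :
    (lcGGJData κ FB R₀ q₀ a g r).MercierCriterion
      ↔ 0 < lcMercierSlope κ FB R₀ q₀ a r
          ∧ lcMercierIntercept κ FB R₀ q₀ a r < g ^ 2 * lcMercierSlope κ FB R₀ q₀ a r := by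
  constructor
  · intro h
    refine ⟨lcMercierSlope_pos_of_mercierCriterion hR₀ hκ hFB hq₀ hr h2r h, ?_⟩
    unfold SurfaceData.MercierCriterion at h
    rw [mercierF_lcGGJData_explicit hR₀ hκ hFB hq₀ hr h2r a g] at h
    linarith
  · rintro ⟨-, h⟩
    unfold SurfaceData.MercierCriterion
    rw [mercierF_lcGGJData_explicit hR₀ hκ hFB hq₀ hr h2r a g]
    linarith

/-- If `g²·M₂ ≤ M₀` the criterion fails (in particular for all sufficiently small `|g|`).
[cite: Jardin2010, §8.5.4 eq. (8.134)] -/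
theorem not_mercierCriterion_of_sq_mul_slope_le {a g : ℝ}
    (h : g ^ 2 * lcMercierSlope κ FB R₀ q₀ a r ≤ lcMercierIntercept κ FB R₀ q₀ a r) :
    ¬ (lcGGJData κ FB R₀ q₀ a g r).MercierCriterion := by
  rw [mercierCriterion_lcGGJData_iff hR₀ hκ hFB hq₀ hr h2r a g]
  rintro ⟨-, h'⟩
  linarith

omit hR₀ hκ hFB hq₀ hr h2r in
/-- The Mercier THRESHOLD of the surface in the free constant: `g_M = √(M₀/M₂)` (meaningful when `M₂ > 0`).
MODELLED: a functional of the analytic model surface. [cite: Jardin2010, §8.5.4 eq. (8.134)] -/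
def lcMercierThreshold (κ FB R₀ q₀ a r : ℝ) : ℝ :=
  Real.sqrt (lcMercierIntercept κ FB R₀ q₀ a r / lcMercierSlope κ FB R₀ q₀ a r)

/-- `g_M > 0` whenever the slope is positive. [cite: Jardin2010, §8.5.4 eq. (8.134)] -/
theorem lcMercierThreshold_pos {a : ℝ} (hM : 0 < lcMercierSlope κ FB R₀ q₀ a r) :
    0 < lcMercierThreshold κ FB R₀ q₀ a r := by
  unfold lcMercierThreshold
  exact Real.sqrt_pos.mpr (div_pos (lcMercierIntercept_pos hR₀ hκ hFB hq₀ hr h2r a) hM)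

/-- `g_M² = M₀/M₂` when `M₂ > 0`. [cite: Jardin2010, §8.5.4 eq. (8.134)] -/
theorem lcMercierThreshold_sq {a : ℝ} (hM : 0 < lcMercierSlope κ FB R₀ q₀ a r) :
    lcMercierThreshold κ FB R₀ q₀ a r ^ 2 = lcMercierIntercept κ FB R₀ q₀ a r / lcMercierSlope κ FB R₀ q₀ a r := by
  unfold lcMercierThreshold
  rw [Real.sq_sqrt (div_pos (lcMercierIntercept_pos hR₀ hκ hFB hq₀ hr h2r a) hM).le]

/-- **Threshold form (positive slope):** `MercierCriterion ↔ g_M < |g|`. [cite: Jardin2010, §8.5.4 eq. (8.134)] -/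
theorem mercierCriterion_lcGGJData_iff_threshold_lt_abs {a : ℝ} (hM : 0 < lcMercierSlope κ FB R₀ q₀ a r)
    (g : ℝ) :
    (lcGGJData κ FB R₀ q₀ a g r).MercierCriterion ↔ lcMercierThreshold κ FB R₀ q₀ a r < |g| := by
  rw [mercierCriterion_lcGGJData_iff_of_slope_pos hR₀ hκ hFB hq₀ hr h2r a g hM,
    ← lcMercierThreshold_sq hR₀ hκ hFB hq₀ hr h2r hM, ← sq_abs g]
  have h0 := (lcMercierThreshold_pos hR₀ hκ hFB hq₀ hr h2r hM).le
  exact pow_lt_pow_iff_left₀ h0 (abs_nonneg g) two_ne_zero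

/-- Threshold form for `g ≥ 0`: `MercierCriterion ↔ g_M < g`. [cite: Jardin2010, §8.5.4 eq. (8.134)] -/
theorem mercierCriterion_lcGGJData_iff_threshold_lt {a : ℝ} (hM : 0 < lcMercierSlope κ FB R₀ q₀ a r)
    {g : ℝ} (hg : 0 ≤ g) :
    (lcGGJData κ FB R₀ q₀ a g r).MercierCriterion ↔ lcMercierThreshold κ FB R₀ q₀ a r < g := by
  rw [mercierCriterion_lcGGJData_iff_threshold_lt_abs hR₀ hκ hFB hq₀ hr h2r hM, abs_of_nonneg hg]

/-- Failure form (positive slope): `¬ MercierCriterion ↔ |g| ≤ g_M`. [cite: Jardin2010, §8.5.4 eq. (8.134)] -/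
theorem not_mercierCriterion_lcGGJData_iff_abs_le {a : ℝ} (hM : 0 < lcMercierSlope κ FB R₀ q₀ a r) (g : ℝ) :
    ¬ (lcGGJData κ FB R₀ q₀ a g r).MercierCriterion ↔ |g| ≤ lcMercierThreshold κ FB R₀ q₀ a r := by
  rw [mercierCriterion_lcGGJData_iff_threshold_lt_abs hR₀ hκ hFB hq₀ hr h2r hM, not_lt]

/-- At the threshold the Mercier function vanishes: `F(±g_M) = 0` (marginal surface).
[cite: Jardin2010, §8.5.4 eq. (8.134)] -/
theorem mercierF_lcGGJData_threshold {a : ℝ} (hM : 0 < lcMercierSlope κ FB R₀ q₀ a r) :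
    (lcGGJData κ FB R₀ q₀ a (lcMercierThreshold κ FB R₀ q₀ a r) r).mercierF = 0
    ∧ (lcGGJData κ FB R₀ q₀ a (-lcMercierThreshold κ FB R₀ q₀ a r) r).mercierF = 0 := by
  rw [mercierF_lcGGJData_explicit hR₀ hκ hFB hq₀ hr h2r, mercierF_lcGGJData_explicit hR₀ hκ hFB hq₀ hr h2r,
    neg_sq, lcMercierThreshold_sq hR₀ hκ hFB hq₀ hr h2r hM]
  constructor <;> field_simp <;> ring

/-- **No surface is Mercier-stable for all values of the free constant:** there is `g₀ > 0` (explicitly `g_M` if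
`M₂ > 0`, else any positive number) such that every `|g| ≤ g₀` violates the criterion.
[cite: Jardin2010, §8.5.4 eq. (8.134)] -/
theorem exists_pos_forall_abs_le_not_mercierCriterion (a : ℝ) :
    ∃ g₀ : ℝ, 0 < g₀ ∧ ∀ g : ℝ, |g| ≤ g₀ → ¬ (lcGGJData κ FB R₀ q₀ a g r).MercierCriterion := by
  by_cases hM : 0 < lcMercierSlope κ FB R₀ q₀ a r
  · exact ⟨lcMercierThreshold κ FB R₀ q₀ a r, lcMercierThreshold_pos hR₀ hκ hFB hq₀ hr h2r hM, fun g hg =>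
      (not_mercierCriterion_lcGGJData_iff_abs_le hR₀ hκ hFB hq₀ hr h2r hM g).mpr hg⟩
  · exact ⟨1, one_pos, fun g _ => not_mercierCriterion_of_slope_nonpos hR₀ hκ hFB hq₀ hr h2r (not_lt.mp hM) g⟩

/-- **The Mercier-stable set in the free constant is a threshold ray (in `|g|`) or empty.**
[cite: Jardin2010, §8.5.4 eq. (8.134)] -/
theorem setOf_mercierCriterion_eq (a : ℝ) :
    {g : ℝ | (lcGGJData κ FB R₀ q₀ a g r).MercierCriterion}
      = if 0 < lcMercierSlope κ FB R₀ q₀ a r then {g : ℝ | lcMercierThreshold κ FB R₀ q₀ a r < |g|} else ∅ := by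
  split_ifs with hM
  · ext g
    simp only [mem_setOf_eq]
    exact mercierCriterion_lcGGJData_iff_threshold_lt_abs hR₀ hκ hFB hq₀ hr h2r hM g
  · ext g
    simp only [mem_setOf_eq, mem_empty_iff_false, iff_false]
    exact not_mercierCriterion_of_slope_nonpos hR₀ hκ hFB hq₀ hr h2r (not_lt.mp hM) g

/-- The criterion is even in `g` (only `g²` enters). [cite: Jardin2010, §8.5.4 eq. (8.134)] -/
theorem mercierCriterion_lcGGJData_neg_iff (a g : ℝ) :
    (lcGGJData κ FB R₀ q₀ a (-g) r).MercierCriterion ↔ (lcGGJData κ FB R₀ q₀ a g r).MercierCriterion := by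
  rw [mercierCriterion_lcGGJData_iff hR₀ hκ hFB hq₀ hr h2r, mercierCriterion_lcGGJData_iff hR₀ hκ hFB hq₀ hr h2r,
    neg_sq]

/-- **Positive slope = «stabilisable by a toroidal field»:** `M₂ > 0 ↔ ∃ g, MercierCriterion`
(witness `g = g_M + 1`). [cite: Jardin2010, §8.5.4 eq. (8.134)] -/
theorem lcMercierSlope_pos_iff_exists_mercierCriterion (a : ℝ) :
    0 < lcMercierSlope κ FB R₀ q₀ a r ↔ ∃ g : ℝ, (lcGGJData κ FB R₀ q₀ a g r).MercierCriterion := by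
  constructor
  · intro hM
    refine ⟨lcMercierThreshold κ FB R₀ q₀ a r + 1, ?_⟩
    rw [mercierCriterion_lcGGJData_iff_threshold_lt_abs hR₀ hκ hFB hq₀ hr h2r hM]
    have h0 := lcMercierThreshold_pos hR₀ hκ hFB hq₀ hr h2r hM
    rw [abs_of_pos (by linarith)]
    linarith
  · rintro ⟨g, hg⟩
    exact lcMercierSlope_pos_of_mercierCriterion hR₀ hκ hFB hq₀ hr h2r hg

end threshold

end Literature.MathematicalPhysics.MHD.Solovev
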